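import Literature.NumberTheory.EllipticCurves.HeegnerPointsKolyvaginCebotarevProofs
import Literature.NumberTheory.EllipticCurves.SupersingularDensitySerreTraceProofs
import Literature.NumberTheory.EllipticCurves.GeomReductionFrobeniusProofs
import Literature.NumberTheory.EllipticCurves.OrdinaryPrimesProofs
import Literature.NumberTheory.EllipticCurves.GlobalMinimalModel
import Literature.NumberTheory.GaloisRepresentations.LocalWeilDatum
import Literature.NumberTheory.Automorphic.TunnellLemma
import HarnessLib

/-!
# The auxiliary inert prime of the aux-norm line from ONE Frobenius witness (Chebotarev step)

Helper file for crux `stmt-BirchSwinnertonDyer-19715` (`ErratumRoadFive.EulerHalfNotRamNoInertSetAtFive`),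
line `aux_norm_receptacle` (bsd-idea-9 g8), stub S3♭ `stub_auxiliaryPrimeSupply` — step (F2) of the
decomposition F1–F4 (seat bsd-line-er5-p1-w2 g5). Theorems only; sorry-free; nothing here closes 19715.

`exists_auxPrime_of_frobeniusWitness`: `E = W/ℚ` globally minimal, `K` imaginary quadratic with a
`ℚ`-embedding `e : K → ℚ̄`, `p` prime, `E ≥ 1`, `ζ ∈ ℚ̄` a primitive `p^E`-th root of unity,
`β ∈ 𝓞_K`, `α ∈ ℚ̄` with `α^p = e(β)`. If ONE `γ ∈ Γ_ℚ` has (i) `γ ∉ res Γ_K`, (ii) `γ ζ = ζ⁻¹`,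
(iii) `tr ρ̄_{E,p}(γ) ≠ 0`, (iv) `γ² α ≠ α`, then for every finite `T` there is a prime `ℓ ∉ T`,
inert in `K`, with `p^E ∣ ℓ + 1`, `p ∤ a_ℓ(E)` and `β^{(ℓ²-1)/p} ≢ 1 (mod ℓ𝓞_K)` — the four
clauses S3♭ asks of its auxiliary prime (the last one feeds F1,
`RingClass.pow_dvd_orderOf_primeClass_of_inert`).
Proof (pattern of the tree's `exists_kolyvaginPrime_gt`, Gross 1991 §3): (i)–(iv) cut out an open
subset of `Γ_ℚ` (stabilisers of algebraic numbers and `ker ρ̄_{E,p}` are open, `res Γ_K` is closed),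
non-empty by hypothesis; Chebotarev (`absoluteGaloisGroup.frobenius_dense`, proved in the tree) puts
an arithmetic Frobenius `γ₁` at `𝔓₀ ∣ ℓ` in it, `ℓ ∤ p Δ_min N(β)`, `ℓ ∉ T`, `ℓ` unramified in `K`.
Then (i) ⟹ `ℓ` inert (`exists_place_inert_of_not_mem_range`); (ii) ⟹ `ζ^ℓ = γ₁ζ = ζ⁻¹`, so
`p^E ∣ ℓ+1` (`AlgHom.IsArithFrobAt.apply_of_pow_eq_one`); (iii) ⟹ `a_ℓ ≡ tr ρ̄(γ₁) ≢ 0 (mod p)`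
(`trace_galoisRepTorsion_frobenius_eq`, Serre (238)); (iv) ⟹ `γ₁²α = ηα`, `η^p = 1 ≠ η`,
`α^{ℓ²} ≡ ηα (mod 𝔓₀)`, so `e(β)^{(ℓ²-1)/p} = α^{ℓ²-1} ≡ η ≢ 1 (mod 𝔓₀)`.

References: B. H. Gross, *Kolyvagin's work on modular elliptic curves*, LMS LNS 153 (1991), §3
[GrossLMS1991]; J.-P. Serre, Publ. Math. IHÉS 54 (1981), §8.1 (238) [Serre1981]; D. A. Cox,
*Primes of the form x² + ny²* (2013), Thm. 8.12 [Cox2013].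
-/

noncomputable section

set_option linter.dupNamespace false -- `Summit.BirchSwinnertonDyer.BirchSwinnertonDyer` (summit = problem), tree-wide

open scoped Classical Pointwise NumberField
open WeierstrassCurve NumberField IsDedekindDomain Field
open Literature.NumberTheory.GaloisRepresentations Literature.NumberTheory.EllipticCurves

namespace Summit.BirchSwinnertonDyer.BirchSwinnertonDyer.Theorems.AuxPrimeSupply

/-! ### Small lemmas on `\bar ℤ = absIntegers (𝓞 ℚ) ℚ` -/

/-- A rational prime `ℓ ∈ v` lies in every prime `𝔓 ∣ v` of `\bar ℤ`. [folklore] -/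
theorem natCast_mem_of_mem_primesAbove {ℓ : ℕ} {v : HeightOneSpectrum (𝓞 ℚ)}
    (hℓv : (ℓ : 𝓞 ℚ) ∈ v.asIdeal) {𝔓 : Ideal (absIntegers (𝓞 ℚ) ℚ)} (h𝔓 : 𝔓 ∈ v.primesAbove) :
    ((ℓ : ℕ) : absIntegers (𝓞 ℚ) ℚ) ∈ 𝔓 := by
  have hover : v.asIdeal = 𝔓.under (𝓞 ℚ) := h𝔓.2.over
  have h : (ℓ : 𝓞 ℚ) ∈ 𝔓.under (𝓞 ℚ) := hover ▸ hℓv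
  rw [Ideal.under_def, Ideal.mem_comap, map_natCast] at h
  exact h

/-- If a natural number `n` lies in a prime `𝔓 ∣ ℓ` of `\bar ℤ` then `ℓ ∣ n`. [folklore] -/
theorem dvd_of_natCast_mem_of_mem_primesAbove {ℓ : ℕ} (hℓ : ℓ.Prime) {v : HeightOneSpectrum (𝓞 ℚ)}
    (hℓv : (ℓ : 𝓞 ℚ) ∈ v.asIdeal) {𝔓 : Ideal (absIntegers (𝓞 ℚ) ℚ)} (h𝔓 : 𝔓 ∈ v.primesAbove)
    {n : ℕ} (hn : ((n : ℕ) : absIntegers (𝓞 ℚ) ℚ) ∈ 𝔓) : ℓ ∣ n := by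
  have hover : v.asIdeal = 𝔓.under (𝓞 ℚ) := h𝔓.2.over
  have h : (n : 𝓞 ℚ) ∈ v.asIdeal := by
    rw [hover, Ideal.under_def, Ideal.mem_comap, map_natCast]
    exact hn
  rw [← span_natCast_rat_eq hℓ hℓv, Ideal.mem_span_singleton] at h
  have h' := map_dvd (Rat.ringOfIntegersEquiv : 𝓞 ℚ ≃+* ℤ) h
  rw [map_natCast, map_natCast] at h'
  exact Int.natCast_dvd_natCast.mp h'

/-- A `p`-th root of unity `η ≠ 1` (`p` prime) is not `≡ 1` modulo an ideal `𝔓` of `\bar ℤ` not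
containing `p`: otherwise `0 = 1 + η + ⋯ + η^{p-1} ≡ p (mod 𝔓)`. [folklore] -/
theorem sub_one_not_mem_of_pow_prime_eq_one {p : ℕ} (hp : p.Prime)
    {𝔓 : Ideal (absIntegers (𝓞 ℚ) ℚ)} (hp𝔓 : ((p : ℕ) : absIntegers (𝓞 ℚ) ℚ) ∉ 𝔓)
    {η : absIntegers (𝓞 ℚ) ℚ} (hη : η ^ p = 1) (hη1 : η ≠ 1) : η - 1 ∉ 𝔓 := by
  intro h1
  have hord : orderOf η = p := by
    rcases (Nat.dvd_prime hp).mp (orderOf_dvd_of_pow_eq_one hη) with h | h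
    · exact absurd (orderOf_eq_one_iff.mp h) hη1
    · exact h
  have hprim : IsPrimitiveRoot η p := hord ▸ IsPrimitiveRoot.orderOf η
  have hsum : (Finset.range p).sum (fun i => η ^ i) = 0 := hprim.geom_sum_eq_zero hp.one_lt
  have hmem : (Finset.range p).sum (fun i => (η ^ i - 1)) ∈ 𝔓 := by
    refine 𝔓.sum_mem fun i _ => ?_
    obtain ⟨r, hr⟩ := sub_one_dvd_pow_sub_one η i
    rw [hr]
    exact 𝔓.mul_mem_right _ h1
  rw [Finset.sum_sub_distrib, hsum, Finset.sum_const, Finset.card_range, nsmul_eq_mul, mul_one,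
    zero_sub, neg_mem_iff] at hmem
  exact hp𝔓 hmem

/-- The image of an algebraic integer of `K` under a `ℚ`-embedding `K → ℚ̄` is integral over `𝓞 ℚ`
(so lies in `\bar ℤ`). [folklore] -/
theorem isIntegral_embedding {K : Type*} [Field K] [NumberField K]
    (e : K →ₐ[ℚ] AlgebraicClosure ℚ) (x : 𝓞 K) : IsIntegral (𝓞 ℚ) (e (x : K)) := by
  refine IsIntegral.tower_top (R := ℤ) (A := 𝓞 ℚ) ?_
  have h := (RingOfIntegers.isIntegral_coe x).map e.toRingHom.toIntAlgHom
  simpa using h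

/-- A preimage under a group homomorphism with OPEN kernel is open (it is a union of cosets of
the kernel). [folklore] -/
theorem isOpen_preimage_of_isOpen_ker {G H : Type*} [Group G] [TopologicalSpace G]
    [ContinuousMul G] [Group H] (f : G →* H) (hf : IsOpen (f.ker : Set G)) (A : Set H) :
    IsOpen (f ⁻¹' A) := by
  have h : f ⁻¹' A = (f ⁻¹' A) * (f.ker : Set G) := by
    refine Set.ext fun g ↦ ⟨fun hg ↦ ⟨g, hg, 1, f.ker.one_mem, mul_one g⟩, ?_⟩
    rintro ⟨a, ha, k, hk, rfl⟩
    show f (a * k) ∈ A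
    rwa [map_mul, (MonoidHom.mem_ker).mp hk, mul_one]
  exact h ▸ hf.mul_left

/-! ### The Chebotarev step -/

/-- **The auxiliary inert prime from one Frobenius witness** (S3♭ step F2). `W/ℚ` globally
minimal, `K` imaginary quadratic with a `ℚ`-embedding `e : K → ℚ̄`, `p` prime, `1 ≤ E`, `ζ` a
primitive `p^E`-th root of unity in `ℚ̄`, `β ∈ 𝓞_K`, `α ∈ ℚ̄` with `α^p = e β`. If some `γ ∈ Γ_ℚ`
has (i) `γ ∉ res Γ_K`, (ii) `γ • ζ = ζ⁻¹`, (iii) `tr ρ̄_{E,p}(γ) ≠ 0` on `E[p]`, (iv) `γ² • α ≠ α`,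
then for every finite `T` there is a prime `ℓ ∉ T`, inert in `K` (`ℓ𝓞_K` prime), with `p^E ∣ ℓ+1`,
`p ∤ a_ℓ(W)` and `β^{(ℓ²-1)/p} - 1 ∉ ℓ𝓞_K`. Proof in the module docstring (Chebotarev density via
`absoluteGaloisGroup.frobenius_dense`; Serre (238); Frobenius on roots of unity).
[cite: GrossLMS1991, §3 (p. 239)] [cite: Serre1981, §8.1 (238)] [cite: Cox2013, Thm. 8.12] -/
theorem exists_auxPrime_of_frobeniusWitness (W : WeierstrassCurve ℚ) [W.IsElliptic]
    [W.IsGloballyMinimal] {K : Type} [Field K] [NumberField K] (hK : IsImaginaryQuadratic K)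
    {p : ℕ} [Fact p.Prime] {E : ℕ} (hE : 1 ≤ E) (e : K →ₐ[ℚ] AlgebraicClosure ℚ) {β : 𝓞 K}
    {ζ α : AlgebraicClosure ℚ} (hζ : IsPrimitiveRoot ζ (p ^ E)) (hα : α ^ p = e (β : K))
    {γ : absoluteGaloisGroup ℚ} (h1 : γ ∉ (absGaloisRestrict ℚ K).range) (h2 : γ • ζ = ζ⁻¹)
    (h3 : letI : Module (ZMod p) (geomTorsion W p) := AddSubgroup.torsionBy.zmodModule
      LinearMap.trace (ZMod p) (geomTorsion W p)
        ((galoisRepTorsion W p γ).toAdd.toAddMonoidHom.toZModLinearMap p) ≠ 0)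
    (h4 : (γ * γ) • α ≠ α) (T : Finset ℕ) :
    ∃ ℓ : ℕ, ℓ.Prime ∧ ℓ ∉ T ∧ (Ideal.span {(ℓ : 𝓞 K)}).IsPrime ∧ p ^ E ∣ ℓ + 1 ∧
      ¬ (p : ℤ) ∣ W.frobeniusTrace ℓ ∧
      β ^ ((ℓ ^ 2 - 1) / p) - 1 ∉ Ideal.span {(ℓ : 𝓞 K)} := by
  letI : Module (ZMod p) (geomTorsion W p) := AddSubgroup.torsionBy.zmodModule
  have hp : p.Prime := Fact.out
  haveI : Algebra.IsQuadraticExtension ℚ K := ⟨hK.1⟩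
  have hp0 : ((p : ℕ) : ℤ) ≠ 0 := by exact_mod_cast hp.ne_zero
  -- `β ≠ 0` (else `α = 0` and (iv) fails) and the norm `n₀ = N(β𝓞_K) ∈ (β)`
  have hβ0 : β ≠ 0 := by
    rintro rfl
    have hα0 : α = 0 := pow_eq_zero_iff hp.ne_zero |>.mp (by rw [hα]; simp)
    exact h4 (by rw [hα0, smul_zero])
  have hα0 : α ≠ 0 := by
    intro h
    have : (e (β : K)) = 0 := by rw [← hα, h, zero_pow hp.ne_zero]
    rw [map_eq_zero_iff e e.injective, RingOfIntegers.coe_eq_zero_iff] at this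
    exact hβ0 this
  set n₀ : ℕ := Ideal.absNorm (Ideal.span {β}) with hn₀
  have hn₀0 : n₀ ≠ 0 := by
    rw [hn₀, Ne, Ideal.absNorm_eq_zero_iff, Ideal.span_singleton_eq_bot]
    exact hβ0
  obtain ⟨y, hy⟩ : ∃ y : 𝓞 K, y * β = (n₀ : 𝓞 K) :=
    Ideal.mem_span_singleton'.mp (Ideal.absNorm_mem (Ideal.span {β}))
  -- ### the finite exceptional set of places of `ℚ`
  set B : Finset ℕ := T ∪ {p} ∪ (minimalDiscriminantInt W).natAbs.primeFactors ∪ n₀.primeFactors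
    with hB
  set S₁ : Set (HeightOneSpectrum (𝓞 ℚ)) := {v | ∃ q ∈ B, q.Prime ∧ (q : 𝓞 ℚ) ∈ v.asIdeal}
    with hS₁
  set S₂ : Set (HeightOneSpectrum (𝓞 ℚ)) := {v | ¬ Algebra.IsUnramifiedIn (𝓞 K) v.asIdeal}
    with hS₂
  have hS₁fin : S₁.Finite := by
    have : S₁ ⊆ ⋃ q ∈ (B.filter Nat.Prime), {v | (q : 𝓞 ℚ) ∈ v.asIdeal} := by
      intro v ⟨q, hqB, hq, hqv⟩
      simp only [Set.mem_iUnion, Finset.mem_filter]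
      exact ⟨q, ⟨hqB, hq⟩, hqv⟩
    refine Set.Finite.subset (Set.Finite.biUnion (Finset.finite_toSet _) fun q hq ↦ ?_) this
    rw [Finset.coe_filter, Set.mem_setOf_eq] at hq
    have hsub : {v : HeightOneSpectrum (𝓞 ℚ) | (q : 𝓞 ℚ) ∈ v.asIdeal}.Subsingleton :=
      fun v hv v' hv' ↦ HeightOneSpectrum.eq_of_natCast_mem_rat hq.2 hv hv'
    exact hsub.finite
  have hS₂fin : S₂.Finite := finite_setOf_not_isUnramifiedIn ℚ K
  set S := S₁ ∪ S₂ with hSdef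
  have hSfin : S.Finite := hS₁fin.union hS₂fin
  -- ### the open set of `Γ_ℚ` cut out by (i)–(iv)
  set O : Set (absoluteGaloisGroup ℚ) :=
    {γ' | γ' ∉ (absGaloisRestrict ℚ K).range ∧ γ' • ζ = ζ⁻¹ ∧
      LinearMap.trace (ZMod p) (geomTorsion W p)
        ((galoisRepTorsion W p γ').toAdd.toAddMonoidHom.toZModLinearMap p) ≠ 0 ∧
      (γ' * γ') • α ≠ α} with hO
  have hO₁ : IsOpen {γ' : absoluteGaloisGroup ℚ | γ' ∉ (absGaloisRestrict ℚ K).range} := by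
    have hc := (isClosed_range_absGaloisRestrict ℚ K).isOpen_compl
    convert hc using 1
    ext γ'
    simp only [Set.mem_setOf_eq, Set.mem_compl_iff, Set.mem_range, MonoidHom.mem_range]
    rfl
  have hO₂ : IsOpen {γ' : absoluteGaloisGroup ℚ | γ' • ζ = ζ⁻¹} :=
    isOpen_setOf_smul_mem_of_isOpen_stabilizer ζ (LocalWeilDatum.isOpen_stabilizer ℚ ζ) {ζ⁻¹}
  have hO₃ : IsOpen {γ' : absoluteGaloisGroup ℚ | LinearMap.trace (ZMod p) (geomTorsion W p)
        ((galoisRepTorsion W p γ').toAdd.toAddMonoidHom.toZModLinearMap p) ≠ 0} :=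
    isOpen_preimage_of_isOpen_ker (galoisRepTorsion W p)
      (W.isOpen_ker_galoisRepTorsion_holds (n := (p : ℤ)) hp0)
      {f | LinearMap.trace (ZMod p) (geomTorsion W p) (f.toAdd.toAddMonoidHom.toZModLinearMap p) ≠ 0}
  have hO₄ : IsOpen {γ' : absoluteGaloisGroup ℚ | (γ' * γ') • α ≠ α} := by
    have hst : IsOpen {δ : absoluteGaloisGroup ℚ | δ • α ∈ ({α}ᶜ : Set (AlgebraicClosure ℚ))} :=
      isOpen_setOf_smul_mem_of_isOpen_stabilizer α (LocalWeilDatum.isOpen_stabilizer ℚ α) {α}ᶜ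
    exact hst.preimage (continuous_id.mul continuous_id)
  have hOopen : IsOpen O := by
    have := ((hO₁.inter hO₂).inter hO₃).inter hO₄
    convert this using 1
    ext γ'
    simp only [hO, Set.mem_setOf_eq, Set.mem_inter_iff, and_assoc]
  have hOne : O.Nonempty := ⟨γ, h1, h2, h3, h4⟩
  -- ### Chebotarev: an arithmetic Frobenius `γ₁ ∈ O` at `𝔓₀ ∣ v`, `v ∉ S`
  obtain ⟨γ₁, ⟨hγ₁H, hγ₁ζ, hγ₁tr, hγ₁α⟩, v, hvS, 𝔓₀, h𝔓₀, hγ₁⟩ :=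
    (absoluteGaloisGroup.frobenius_dense Literature.NumberTheory.Automorphic.chebotarev_artinRep_of_galoisSide
      ℚ S hSfin).inter_open_nonempty O hOopen hOne
  haveI h𝔓₀prime : 𝔓₀.IsPrime := h𝔓₀.1
  -- ### the rational prime `ℓ` under `v`
  obtain ⟨ℓ, hℓ, hℓv⟩ := exists_prime_natCast_mem v
  haveI : Fact ℓ.Prime := ⟨hℓ⟩
  have hℓB : ℓ ∉ B := fun h ↦ hvS (Or.inl ⟨ℓ, h, hℓ, hℓv⟩)
  simp only [hB, Finset.mem_union, Finset.mem_singleton, Nat.mem_primeFactors, not_or] at hℓB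
  obtain ⟨⟨⟨hℓT, hℓp⟩, hℓΔ⟩, hℓn₀⟩ := hℓB
  have hℓΔ' : ¬ (ℓ : ℤ) ∣ minimalDiscriminantInt W := fun h ↦
    hℓΔ ⟨hℓ, Int.natCast_dvd.mp h, Int.natAbs_ne_zero.mpr (minimalDiscriminantInt_ne_zero W)⟩
  have hℓn₀' : ¬ ℓ ∣ n₀ := fun h ↦ hℓn₀ ⟨hℓ, h, hn₀0⟩
  have hunr : Algebra.IsUnramifiedIn (𝓞 K) v.asIdeal := by
    by_contra h; exact hvS (Or.inr h)
  have hv : (Rat.HeightOneSpectrum.primesEquiv v : ℕ) = ℓ := by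
    have h1 : Rat.HeightOneSpectrum.natGenerator v ∣ ℓ := by
      rw [Rat.HeightOneSpectrum.natGenerator_dvd_iff,
        ← map_natCast (Rat.IsIntegralClosure.intEquiv (𝓞 ℚ)) ℓ, Ideal.apply_mem_of_equiv_iff]
      exact hℓv
    exact (Nat.prime_dvd_prime_iff_eq (Rat.HeightOneSpectrum.prime_natGenerator v) hℓ).mp h1
  have hℓ𝔓 : ((ℓ : ℕ) : absIntegers (𝓞 ℚ) ℚ) ∈ 𝔓₀ := natCast_mem_of_mem_primesAbove hℓv h𝔓₀
  -- natural numbers prime to `ℓ` are not in `𝔓₀`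
  have hnot : ∀ n : ℕ, ¬ ℓ ∣ n → ((n : ℕ) : absIntegers (𝓞 ℚ) ℚ) ∉ 𝔓₀ := fun n hn hmem ↦
    hn (dvd_of_natCast_mem_of_mem_primesAbove hℓ hℓv h𝔓₀ hmem)
  have hp𝔓 : ((p : ℕ) : absIntegers (𝓞 ℚ) ℚ) ∉ 𝔓₀ :=
    hnot p (fun h ↦ hℓp ((Nat.prime_dvd_prime_iff_eq hℓ hp).mp h))
  have hpE𝔓 : ((p ^ E : ℕ) : absIntegers (𝓞 ℚ) ℚ) ∉ 𝔓₀ :=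
    hnot (p ^ E) (fun h ↦ hℓp ((Nat.prime_dvd_prime_iff_eq hℓ hp).mp (hℓ.dvd_of_dvd_pow h)))
  -- ### (i) `ℓ` is inert in `K`
  have hHi := index_range_absGaloisRestrict_eq_finrank ℚ K
  haveI hHn : ((absGaloisRestrict ℚ K).range).Normal :=
    Subgroup.normal_of_index_eq_two (hHi.trans hK.1)
  have hI := inertia_le_range_absGaloisRestrict_of_isUnramifiedIn (K := K) hunr h𝔓₀
  obtain ⟨w, 𝔔, τ', hwv, hwuniq, -, h𝔔w, -, -, -⟩ :=
    exists_place_inert_of_not_mem_range (F := ℚ) (M := K) (hK.1 ▸ Nat.prime_two) hHn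
      (hHi.trans rfl) hunr h𝔓₀ hI hγ₁ hγ₁H
  have hℓw : (ℓ : 𝓞 K) ∈ w.asIdeal := by
    have h1 : (ℓ : 𝓞 ℚ) ∈ (w.under (𝓞 ℚ)).asIdeal := by rw [hwv]; exact hℓv
    rw [HeightOneSpectrum.under_asIdeal, Ideal.under_def, Ideal.mem_comap, map_natCast] at h1
    exact h1
  have hwuniq' : ∀ w' : HeightOneSpectrum (𝓞 K), (ℓ : 𝓞 K) ∈ w'.asIdeal → w' = w := by
    intro w' hw'
    apply hwuniq
    apply HeightOneSpectrum.eq_of_natCast_mem_rat hℓ _ hℓv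
    rw [HeightOneSpectrum.under_asIdeal, Ideal.under_def, Ideal.mem_comap, map_natCast]
    exact hw'
  have hspan : Ideal.span {(ℓ : 𝓞 K)} = w.asIdeal := by
    apply span_natCast_eq_of_unique hℓ w hwuniq'
    haveI : w.asIdeal.LiesOver v.asIdeal := ⟨by rw [← hwv]; rfl⟩
    have hmap : v.asIdeal.map (algebraMap (𝓞 ℚ) (𝓞 K)) = Ideal.span {(ℓ : 𝓞 K)} := by
      rw [← span_natCast_rat_eq hℓ hℓv, Ideal.map_span, Set.image_singleton, map_natCast]
    have hne : v.asIdeal.map (algebraMap (𝓞 ℚ) (𝓞 K)) ≠ ⊥ := by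
      rw [hmap, Ne, Ideal.span_singleton_eq_bot]; exact_mod_cast hℓ.ne_zero
    rw [← hmap, ← Ideal.IsDedekindDomain.ramificationIdx_eq_normalizedFactors_count v.asIdeal
      w.asIdeal hne]
    exact Ideal.ramificationIdx_eq_one_iff.mpr (hunr w.asIdeal w.isPrime inferInstance)
  have hinert : (Ideal.span {(ℓ : 𝓞 K)}).IsPrime := hspan ▸ w.isPrime
  -- ### (ii) `p^E ∣ ℓ + 1`
  have hq : Nat.card (𝓞 ℚ ⧸ 𝔓₀.under (𝓞 ℚ)) = ℓ :=
    natCard_quotient_under_eq_of_mem_primesAbove hv h𝔓₀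
  have hpE : p ^ E ∣ ℓ + 1 := by
    have hζint : IsIntegral (𝓞 ℚ) ζ :=
      (hζ.isIntegral (pow_pos hp.pos E)).tower_top (A := 𝓞 ℚ)
    set ζ' : absIntegers (𝓞 ℚ) ℚ := ⟨ζ, hζint⟩ with hζ'
    have hζ'pow : ζ' ^ (p ^ E) = 1 := Subtype.ext (by rw [SubmonoidClass.coe_pow]; exact hζ.pow_eq_one)
    have h := hγ₁.apply_of_pow_eq_one hζ'pow hpE𝔓
    rw [hq] at h
    have h' := congrArg (fun z : absIntegers (𝓞 ℚ) ℚ ↦ (z : AlgebraicClosure ℚ)) h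
    simp only [MulSemiringAction.toAlgHom_apply, integralClosure.coe_smul, SubmonoidClass.coe_pow]
      at h'
    -- `h' : γ₁ • ζ = ζ ^ ℓ`, and `γ₁ • ζ = ζ⁻¹`
    have hζ0 : ζ ≠ 0 := hζ.ne_zero (pow_ne_zero E hp.ne_zero)
    have hone : ζ ^ (ℓ + 1) = 1 := by
      rw [pow_succ, ← h', hγ₁ζ, inv_mul_cancel₀ hζ0]
    exact (hζ.pow_eq_one_iff_dvd (ℓ + 1)).mp hone
  -- ### (iii) `p ∤ a_ℓ`
  have hgood : W.HasGoodReductionAtPrime ℓ := hasGoodReductionAtPrime_of_not_dvd W ℓ hℓΔ'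
  have htr := W.trace_galoisRepTorsion_frobenius_eq p (p := ℓ) hℓp hgood hv h𝔓₀ hγ₁
  have haℓ : ¬ (p : ℤ) ∣ W.frobeniusTrace ℓ := by
    intro hdvd
    apply hγ₁tr
    rw [htr]
    exact (ZMod.intCast_zmod_eq_zero_iff_dvd _ p).mpr hdvd
  -- ### (iv) the Kummer residue condition
  -- `γ₁² ∈ res Γ_K` fixes `e β`
  have hsq : γ₁ * γ₁ ∈ (absGaloisRestrict ℚ K).range := by
    haveI := finiteIndex_range_absGaloisRestrict ℚ K
    have h := Subgroup.pow_index_mem (absGaloisRestrict ℚ K).range γ₁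
    rw [hHi, hK.1, pow_two] at h
    exact h
  obtain ⟨g, hg⟩ := hsq
  have hfixβ : (γ₁ * γ₁) • e (β : K) = e (β : K) := by
    rw [← hg]
    exact absGaloisRestrict_smul_apply_eq g e (β : K)
  -- `η = γ₁²α / α` is a `p`-th root of unity `≠ 1`
  set η : AlgebraicClosure ℚ := ((γ₁ * γ₁) • α) * α⁻¹ with hηdef
  have hηα : (γ₁ * γ₁) • α = η * α := by rw [hηdef, inv_mul_cancel_right₀ hα0]
  have heβ0 : e (β : K) ≠ 0 := by rw [← hα]; exact pow_ne_zero p hα0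
  have hηp : η ^ p = 1 := by
    rw [hηdef, mul_pow, inv_pow, ← smul_pow', hα, hfixβ, mul_inv_cancel₀ heβ0]
  have hη1 : η ≠ 1 := by
    intro h; apply hγ₁α; rw [hηα, h, one_mul]
  -- ### move to `\bar ℤ` and reduce modulo `𝔓₀`
  have hηint : IsIntegral (𝓞 ℚ) η :=
    (IsIntegral.of_pow (R := ℤ) hp.pos (by rw [hηp]; exact isIntegral_one)).tower_top (A := 𝓞 ℚ)
  have hαint : IsIntegral (𝓞 ℚ) α :=
    IsIntegral.of_pow (R := 𝓞 ℚ) hp.pos (by rw [hα]; exact isIntegral_embedding e β)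
  set α' : absIntegers (𝓞 ℚ) ℚ := ⟨α, hαint⟩ with hα'def
  set η' : absIntegers (𝓞 ℚ) ℚ := ⟨η, hηint⟩ with hη'def
  set b' : absIntegers (𝓞 ℚ) ℚ := ⟨e (β : K), isIntegral_embedding e β⟩ with hb'def
  set y' : absIntegers (𝓞 ℚ) ℚ := ⟨e (y : K), isIntegral_embedding e y⟩ with hy'def
  have hα'p : α' ^ p = b' := Subtype.ext (by rw [SubmonoidClass.coe_pow]; exact hα)
  have hη'p : η' ^ p = 1 := Subtype.ext (by rw [SubmonoidClass.coe_pow]; exact hηp)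
  have hη'1 : η' ≠ 1 := fun h ↦ hη1 (congrArg Subtype.val h)
  have hsmul : (γ₁ * γ₁) • α' = η' * α' :=
    Subtype.ext (by rw [integralClosure.coe_smul, MulMemClass.coe_mul]; exact hηα)
  have hyK : (y : K) * (β : K) = (n₀ : K) := by
    have h := congrArg (algebraMap (𝓞 K) K) hy
    rw [map_mul, map_natCast] at h
    exact h
  have hyb : y' * b' = ((n₀ : ℕ) : absIntegers (𝓞 ℚ) ℚ) := by
    apply Subtype.ext
    rw [MulMemClass.coe_mul]
    show e (y : K) * e (β : K) = (((n₀ : ℕ) : absIntegers (𝓞 ℚ) ℚ) : AlgebraicClosure ℚ)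
    rw [← map_mul, hyK, map_natCast]
    norm_cast
  set π := Ideal.Quotient.mk 𝔓₀ with hπ
  haveI : IsDomain (absIntegers (𝓞 ℚ) ℚ ⧸ 𝔓₀) := Ideal.Quotient.isDomain 𝔓₀
  have hF : ∀ x : absIntegers (𝓞 ℚ) ℚ, π (γ₁ • x) = π x ^ ℓ := fun x ↦ by
    rw [← map_pow, hπ, Ideal.Quotient.eq]
    exact smul_sub_pow_mem_of_isArithFrobAt hv h𝔓₀ hγ₁ x
  have hkey : π η' * π α' = π α' ^ (ℓ * ℓ) := by
    rw [← map_mul, ← hsmul, mul_smul, hF, hF, ← pow_mul]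
  have hα'𝔓 : π α' ≠ 0 := by
    intro h0
    have hb : π b' = 0 := by rw [← hα'p, map_pow, h0, zero_pow hp.ne_zero]
    have hn : π ((n₀ : ℕ) : absIntegers (𝓞 ℚ) ℚ) = 0 := by rw [← hyb, map_mul, hb, mul_zero]
    rw [hπ, Ideal.Quotient.eq_zero_iff_mem] at hn
    exact hnot n₀ hℓn₀' hn
  have hℓℓ : 1 ≤ ℓ * ℓ := Nat.one_le_iff_ne_zero.mpr (mul_ne_zero hℓ.ne_zero hℓ.ne_zero)
  have hηeq : π η' = π α' ^ (ℓ * ℓ - 1) := by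
    have h1 : π α' ^ (ℓ * ℓ) = π α' ^ (ℓ * ℓ - 1) * π α' := by
      rw [← pow_succ, Nat.sub_add_cancel hℓℓ]
    rw [h1] at hkey
    exact mul_right_cancel₀ hα'𝔓 hkey
  -- `p ∣ ℓ² - 1 = ℓ·ℓ - 1`
  have hsq : ℓ ^ 2 - 1 = (ℓ + 1) * (ℓ - 1) := by
    obtain ⟨k, rfl⟩ : ∃ k, ℓ = k + 1 := ⟨ℓ - 1, (Nat.sub_add_cancel hℓ.one_le).symm⟩
    rw [Nat.add_sub_cancel]
    exact Nat.sub_eq_of_eq_add (by ring)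
  have hpdvd : p ∣ ℓ ^ 2 - 1 := by
    rw [hsq]
    exact ((dvd_pow_self p (by omega : E ≠ 0)).trans hpE).mul_right _
  obtain ⟨k, hk⟩ := hpdvd
  have hkdiv : (ℓ ^ 2 - 1) / p = k := by rw [hk, Nat.mul_div_cancel_left _ hp.pos]
  have hpk : p * k = ℓ * ℓ - 1 := by rw [← hk, pow_two]
  refine ⟨ℓ, hℓ, hℓT, hinert, hpE, haℓ, ?_⟩
  rw [hkdiv]
  intro hcon
  obtain ⟨z, hz⟩ := Ideal.mem_span_singleton'.mp hcon
  set z' : absIntegers (𝓞 ℚ) ℚ := ⟨e (z : K), isIntegral_embedding e z⟩ with hz'def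
  -- `b'^k - 1 = z' * ℓ ∈ 𝔓₀`
  have hzK : (z : K) * (ℓ : K) = (β : K) ^ k - 1 := by
    have h := congrArg (algebraMap (𝓞 K) K) hz
    rw [map_mul, map_natCast, map_sub, map_pow, map_one] at h
    exact h
  have hbk : b' ^ k - 1 = z' * ((ℓ : ℕ) : absIntegers (𝓞 ℚ) ℚ) := by
    apply Subtype.ext
    rw [MulMemClass.coe_mul, AddSubgroupClass.coe_sub, SubmonoidClass.coe_pow, OneMemClass.coe_one]
    show e (β : K) ^ k - 1 = e (z : K) * (((ℓ : ℕ) : absIntegers (𝓞 ℚ) ℚ) : AlgebraicClosure ℚ)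
    have h2 : e (z : K) * (ℓ : AlgebraicClosure ℚ) = e (β : K) ^ k - 1 := by
      rw [← map_natCast e ℓ, ← map_mul, hzK, map_sub, map_pow, map_one]
    rw [← h2]
    norm_cast
  have hbk𝔓 : b' ^ k - 1 ∈ 𝔓₀ := by
    rw [hbk]
    exact 𝔓₀.mul_mem_left _ hℓ𝔓
  -- hence `π η' = 1`, i.e. `η' - 1 ∈ 𝔓₀`: contradiction
  have hπb : π b' ^ k = 1 := by
    rw [← map_pow, ← π.map_one, hπ, Ideal.Quotient.eq]
    exact hbk𝔓
  have hπαp : π α' ^ p = π b' := by rw [← map_pow, hα'p]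
  have hπη : π η' = 1 := by
    rw [hηeq, ← hpk, pow_mul, hπαp]
    exact hπb
  have : η' - 1 ∈ 𝔓₀ := by
    rw [← Ideal.Quotient.eq, ← hπ, hπη, map_one]
  exact sub_one_not_mem_of_pow_prime_eq_one hp hp𝔓 hη'p hη'1 this

end Summit.BirchSwinnertonDyer.BirchSwinnertonDyer.Theorems.AuxPrimeSupply

end
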